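import Summits.NavierStokesRegularity.NavierStokesRegularity.Theorems.EulerZoomLiouvillePowerGaugeEulerLiouvilleNeedleChartFastArea
import Summits.NavierStokesRegularity.NavierStokesRegularity.Theorems.EulerZoomLiouvillePowerGaugeEulerLiouvilleNeedleSectorTonelli
import Summits.NavierStokesRegularity.NavierStokesRegularity.Theorems.EulerZoomLiouvillePowerGaugeEulerLiouvilleNeedleAxisymThinTube

/-!
# Thin fast exits WITHOUT SYMMETRY — structural part: good radii, the six chart tubes, the cover
# (plate t39c-C of ROUND-38 «the waiting-time exponent»; crux E `PowerGaugeEulerLiouville`,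
# stmt-NavierStokesRegularity-19832)

LANDING PLATE prepared by nsreg-p2 g33 (TEXT custody, DIRECTOR-NS #199 (1)) for a keyed PROVER hand
(`--supports stmt-NavierStokesRegularity-19832 --as helper`).  No Euler content, NO SYMMETRY.

For a `C¹` field `U` on `ℝ³`, a threshold `γ > 0`, a dyadic scale `R ≥ 1` with ball budgets
`∫_{B_{2R}} ‖U‖² ≤ B_A`, `∫_{B_{2R}} ‖DU‖² ≤ B_E`, and a band number `J ≥ 1` admissible for the band law uniformly over
the radii `t ∈ (R, 2R)`:
* GOOD RADII (`goodRadii`): the radii at which the two chart energies of a frame (`chartBudget`, over the chart disc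
  `‖z‖ < 9t/10`) stay below `𝒜 = 48(B_A+1)/R`, `ℰ = 48(B_E+1)/R`; by the cone Tonelli of ROUND-36 and Chebyshev the
  bad radii of one frame have measure `≤ R/24` (`volume_Ioo_diff_goodRadii_le`), so the radii good for all SIX signed
  frames have measure `≥ 3R/4`;
* TUBES (`tube`): the `γ`-fast points of the aperture-`17/20` sector of a frame over the good radii; by the REVERSE
  cone Tonelli (`NeedleSectorTonelli.lintegral_sector_le`) and the per-chart decay (`NeedleChartFastArea.chart_fastArea_le`)
  `|tube| ≤ 8𝒜e^{−J/4}/(γ²R)·` (`volume_tube_le`);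
* `thinFastExits_structural`: with `G = {t² : t good for all six frames}` (`|G| ≥ R²`) and `N =` the union of the six
  tubes, every `γ`-fast `y` with `‖y‖² ∈ G` lies in `N ⊆ B_{2R}` (six-cone cover `exists_inner_sq_ge` +
  `mem_sector_of_inner_sq`) and `|N|·∫_N ‖U‖² ≤ 48·𝒜·B_A·e^{−J/4}/(γ²R)`.
The asymptotic choice of `J` (part D, `…NeedleThinFastExits.lean`) turns this into the `hthin` hypothesis of
`NeedleRace.curl_eq_zero_of_thinFastExits` for every `m` — t38j-C's `NeedleAxisymBand.thinFastExits` minus `IsAxisymmetric`.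
[folklore: Chebyshev, Tonelli, pigeonhole; the decay is the band law of plate t39b]
-/

set_option linter.dupNamespace false

open MeasureTheory Set Metric Real
open scoped RealInnerProductSpace ENNReal

namespace Summit.NavierStokesRegularity.NavierStokesRegularity.Theorems.PowerGaugeEulerLiouville.NeedleFastSetMeasure

open NeedleDiscChart NeedleSphereChart NeedleThinness NeedleSphereThinness NeedleSphericalTonelli NeedleBandTest NeedleBandLaw
  NeedleChartFastArea NeedleSectorTonelli NeedleAxisymBand

variable {e e₁ e₂ : (EuclideanSpace ℝ (Fin 3))} {U : (EuclideanSpace ℝ (Fin 3)) → (EuclideanSpace ℝ (Fin 3))}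

/-! ## 1. Chart budgets along the radii -/

/-- The chart energy of the weight `g` at radius `t`: `∫_{‖z‖ < 9t/10} g (Φ_t z) dz`. -/
noncomputable def chartBudget (e e₁ e₂ : (EuclideanSpace ℝ (Fin 3))) (g : (EuclideanSpace ℝ (Fin 3)) → ℝ≥0∞) (t : ℝ) : ℝ≥0∞ :=
  ∫⁻ z in ball (0 : ℂ) (9 / 10 * t), g (sphereChart e e₁ e₂ t z)

/-- The chart budget is a measurable function of the radius. [folklore: Tonelli measurability] -/
theorem measurable_chartBudget (e e₁ e₂ : (EuclideanSpace ℝ (Fin 3))) {g : (EuclideanSpace ℝ (Fin 3)) → ℝ≥0∞} (hg : Measurable g) :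
    Measurable (chartBudget e e₁ e₂ g) := by
  set K : Set (ℝ × ℂ) := {p | ‖p.2‖ < 9 / 10 * p.1} with hKdef
  have hKm : MeasurableSet K := measurableSet_lt continuous_snd.norm.measurable (measurable_fst.const_mul _)
  set H : ℝ × ℂ → ℝ≥0∞ := K.indicator fun p => g (sphereChart e e₁ e₂ p.1 p.2) with hHdef
  have hHm : Measurable H := (hg.comp (continuous_sphereChart₂ e e₁ e₂).measurable).indicator hKm
  have heq : chartBudget e e₁ e₂ g = fun t => ∫⁻ z, H (t, z) := by
    funext t
    rw [chartBudget, ← lintegral_indicator measurableSet_ball]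
    refine lintegral_congr fun z => ?_
    by_cases hz : z ∈ ball (0 : ℂ) (9 / 10 * t)
    · have hK : (t, z) ∈ K := by
        show ‖z‖ < 9 / 10 * t
        exact mem_ball_zero_iff.1 hz
      rw [indicator_of_mem hz, hHdef, indicator_of_mem hK]
    · have hK : (t, z) ∉ K := fun h => hz (mem_ball_zero_iff.2 h)
      rw [indicator_of_notMem hz, hHdef, indicator_of_notMem hK]
  rw [heq]
  exact hHm.lintegral_prod_right'

/-- CONE TONELLI for the chart budget: `∫_{(R,2R)} chartBudget g ≤ ∫_{B_{2R}} g`. [ROUND-36 `lintegral_cone_le`] -/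
theorem lintegral_chartBudget_le (hon : Orthonormal ℝ ![e, e₁, e₂]) {g : (EuclideanSpace ℝ (Fin 3)) → ℝ≥0∞} (hg : Measurable g)
    {R : ℝ} (hR : 0 < R) :
    ∫⁻ t in Ioo R (2 * R), chartBudget e e₁ e₂ g t ≤ ∫⁻ y in closedBall (0 : (EuclideanSpace ℝ (Fin 3))) (2 * R), g y := by
  have he : ‖e‖ = 1 := norm_frame₀ hon
  have h₁ : ‖e₁‖ = 1 := norm_frame₁ hon
  have h₂ : ‖e₂‖ = 1 := norm_frame₂ hon
  have he1 : ⟪e, e₁⟫ = 0 := inner_frame₀₁ hon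
  have he2 : ⟪e, e₂⟫ = 0 := inner_frame₀₂ hon
  have h12 : ⟪e₁, e₂⟫ = 0 := inner_frame₁₂ hon
  have hIpos : ∀ t ∈ Ioo R (2 * R), 0 < t := fun t ht => hR.trans ht.1
  refine lintegral_cone_le hon hg measurableSet_Ioo hIpos (θ := 9 / 10) (by norm_num) measurableSet_closedBall ?_
  intro t ht z hz
  have ht0 := hIpos t ht
  have hzt : ‖z‖ ≤ t := by nlinarith [norm_nonneg z]
  rw [mem_closedBall_zero_iff, norm_sphereChart he h₁ h₂ he1 he2 h12 ht0.le hzt]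
  exact ht.2.le

/-- CHEBYSHEV in the radius: the radii in `(R,2R)` where a budget of total `≤ B` exceeds `48(B+1)/R` have measure
`≤ R/48`. [folklore] -/
theorem volume_bad_le {Φ : ℝ → ℝ≥0∞} (hΦ : Measurable Φ) {R B : ℝ} (hR : 0 < R) (hB0 : 0 ≤ B)
    (hB : ∫⁻ t in Ioo R (2 * R), Φ t ≤ ENNReal.ofReal B) :
    volume ({t | ENNReal.ofReal (48 * (B + 1) / R) ≤ Φ t} ∩ Ioo R (2 * R)) ≤ ENNReal.ofReal (R / 48) := by
  have hlam : 0 < 48 * (B + 1) / R := by positivity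
  have hε : ENNReal.ofReal (48 * (B + 1) / R) ≠ 0 := (ENNReal.ofReal_pos.2 hlam).ne'
  refine (volume_setOf_sphereBudget_ge_le hΦ hB hε ENNReal.ofReal_ne_top).trans ?_
  rw [← ENNReal.ofReal_div_of_pos hlam]
  refine ENNReal.ofReal_le_ofReal ?_
  rw [div_le_iff₀ hlam]
  have h1 : B ≤ B + 1 := by linarith
  calc B = B * 1 := (mul_one B).symm
    _ ≤ (B + 1) * 1 := by nlinarith
    _ = R / 48 * (48 * (B + 1) / R) := by field_simp
    
/-! ## 2. Good radii of one frame -/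

/-- The radii in `(R, 2R)` at which both chart energies of the frame stay below the thresholds `𝒜`, `ℰ`. -/
def goodRadii (e e₁ e₂ : (EuclideanSpace ℝ (Fin 3))) (U : (EuclideanSpace ℝ (Fin 3)) → (EuclideanSpace ℝ (Fin 3))) (R 𝒜 ℰ : ℝ) : Set ℝ :=
  Ioo R (2 * R) ∩ ({t | chartBudget e e₁ e₂ (fun y => ‖U y‖ₑ ^ 2) t < ENNReal.ofReal 𝒜} ∩
    {t | chartBudget e e₁ e₂ (fun y => ‖fderiv ℝ U y‖ₑ ^ 2) t < ENNReal.ofReal ℰ})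

/-- Good radii lie in the dyadic range `(R, 2R)`. [folklore] -/
theorem goodRadii_subset (e e₁ e₂ : (EuclideanSpace ℝ (Fin 3))) (U : (EuclideanSpace ℝ (Fin 3)) → (EuclideanSpace ℝ (Fin 3))) (R 𝒜 ℰ : ℝ) :
    goodRadii e e₁ e₂ U R 𝒜 ℰ ⊆ Ioo R (2 * R) := inter_subset_left

/-- The good radii form a measurable set. [folklore] -/
theorem measurableSet_goodRadii (e e₁ e₂ : (EuclideanSpace ℝ (Fin 3))) (hU : ContDiff ℝ 1 U) (R 𝒜 ℰ : ℝ) :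
    MeasurableSet (goodRadii e e₁ e₂ U R 𝒜 ℰ) := by
  have hmA : Measurable fun y : (EuclideanSpace ℝ (Fin 3)) => ‖U y‖ₑ ^ 2 := (hU.continuous.measurable.enorm).pow_const 2
  have hmE : Measurable fun y : (EuclideanSpace ℝ (Fin 3)) => ‖fderiv ℝ U y‖ₑ ^ 2 :=
    ((hU.continuous_fderiv one_ne_zero).measurable.enorm).pow_const 2
  exact measurableSet_Ioo.inter
    ((measurableSet_lt (measurable_chartBudget e e₁ e₂ hmA) measurable_const).inter
      (measurableSet_lt (measurable_chartBudget e e₁ e₂ hmE) measurable_const))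

/-- The BAD radii of one frame have measure `≤ R/24`. [folklore: Chebyshev + cone Tonelli] -/
theorem volume_Ioo_diff_goodRadii_le (hon : Orthonormal ℝ ![e, e₁, e₂]) (hU : ContDiff ℝ 1 U) {R BA BE : ℝ}
    (hR : 0 < R) (hBA : 0 ≤ BA) (hBE : 0 ≤ BE)
    (hIA : ∫⁻ y in closedBall (0 : (EuclideanSpace ℝ (Fin 3))) (2 * R), ‖U y‖ₑ ^ 2 ≤ ENNReal.ofReal BA)
    (hIE : ∫⁻ y in closedBall (0 : (EuclideanSpace ℝ (Fin 3))) (2 * R), ‖fderiv ℝ U y‖ₑ ^ 2 ≤ ENNReal.ofReal BE) :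
    volume (Ioo R (2 * R) \ goodRadii e e₁ e₂ U R (48 * (BA + 1) / R) (48 * (BE + 1) / R)) ≤ ENNReal.ofReal (R / 24) := by
  have hmA : Measurable fun y : (EuclideanSpace ℝ (Fin 3)) => ‖U y‖ₑ ^ 2 := (hU.continuous.measurable.enorm).pow_const 2
  have hmE : Measurable fun y : (EuclideanSpace ℝ (Fin 3)) => ‖fderiv ℝ U y‖ₑ ^ 2 :=
    ((hU.continuous_fderiv one_ne_zero).measurable.enorm).pow_const 2
  set QA := chartBudget e e₁ e₂ (fun y => ‖U y‖ₑ ^ 2) with hQA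
  set QE := chartBudget e e₁ e₂ (fun y => ‖fderiv ℝ U y‖ₑ ^ 2) with hQE
  have hbadA := volume_bad_le (measurable_chartBudget e e₁ e₂ hmA) hR hBA
    ((lintegral_chartBudget_le hon hmA hR).trans hIA)
  have hbadE := volume_bad_le (measurable_chartBudget e e₁ e₂ hmE) hR hBE
    ((lintegral_chartBudget_le hon hmE hR).trans hIE)
  have hsub : Ioo R (2 * R) \ goodRadii e e₁ e₂ U R (48 * (BA + 1) / R) (48 * (BE + 1) / R) ⊆
      ({t | ENNReal.ofReal (48 * (BA + 1) / R) ≤ QA t} ∩ Ioo R (2 * R)) ∪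
        ({t | ENNReal.ofReal (48 * (BE + 1) / R) ≤ QE t} ∩ Ioo R (2 * R)) := by
    intro t ht
    obtain ⟨htI, htg⟩ := ht
    rw [goodRadii] at htg
    by_cases hA : QA t < ENNReal.ofReal (48 * (BA + 1) / R)
    · have hE : ¬ QE t < ENNReal.ofReal (48 * (BE + 1) / R) := fun hE => htg ⟨htI, hA, hE⟩
      exact Or.inr ⟨not_lt.1 hE, htI⟩
    · exact Or.inl ⟨not_lt.1 hA, htI⟩
  calc volume (Ioo R (2 * R) \ goodRadii e e₁ e₂ U R (48 * (BA + 1) / R) (48 * (BE + 1) / R))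
      ≤ volume (({t | ENNReal.ofReal (48 * (BA + 1) / R) ≤ QA t} ∩ Ioo R (2 * R)) ∪
          ({t | ENNReal.ofReal (48 * (BE + 1) / R) ≤ QE t} ∩ Ioo R (2 * R))) := measure_mono hsub
    _ ≤ volume ({t | ENNReal.ofReal (48 * (BA + 1) / R) ≤ QA t} ∩ Ioo R (2 * R)) +
          volume ({t | ENNReal.ofReal (48 * (BE + 1) / R) ≤ QE t} ∩ Ioo R (2 * R)) := measure_union_le _ _
    _ ≤ ENNReal.ofReal (R / 48) + ENNReal.ofReal (R / 48) := add_le_add hbadA hbadE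
    _ = ENNReal.ofReal (R / 24) := by
        rw [← ENNReal.ofReal_add (by positivity) (by positivity)]
        congr 1
        ring

/-! ## 3. The tube of one frame -/

/-- The `γ`-fast set of `U`: `{y : ⟪U y, y⟫ + γ‖y‖² < 0}`. -/
def fastSet (U : (EuclideanSpace ℝ (Fin 3)) → (EuclideanSpace ℝ (Fin 3))) (γ : ℝ) : Set (EuclideanSpace ℝ (Fin 3)) :=
  {y | ⟪U y, y⟫ + γ * ‖y‖ ^ 2 < 0}

/-- The fast set of a continuous field is open, hence measurable. [folklore] -/
theorem measurableSet_fastSet (hUc : Continuous U) (γ : ℝ) : MeasurableSet (fastSet U γ) :=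
  (isOpen_lt ((hUc.inner continuous_id).add (continuous_const.mul (continuous_norm.pow 2)))
    continuous_const).measurableSet

/-- The TUBE of the frame over the radii `T`: the fast points of the aperture-`17/20` sector of `e` over `T`. -/
def tube (e : (EuclideanSpace ℝ (Fin 3))) (U : (EuclideanSpace ℝ (Fin 3)) → (EuclideanSpace ℝ (Fin 3))) (γ : ℝ) (T : Set ℝ) : Set (EuclideanSpace ℝ (Fin 3)) :=
  sector e T (17 / 20) ∩ fastSet U γ

/-- On the chart disc the fast set IS the level set of the chart flux: for `‖z‖ < θt ≤ t`,
`Φ_t z ∈ fastSet U γ ↔ z ∈ levSet (chartFlux e e₁ e₂ U t) (θt) (γt²)`. [folklore: `‖Φ_t z‖ = t`] -/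
theorem indicator_fastSet_sphereChart_le (hon : Orthonormal ℝ ![e, e₁, e₂]) {γ θ t : ℝ} (ht : 0 < t) (hθ1 : θ ≤ 1)
    {z : ℂ} (hz : z ∈ ball (0 : ℂ) (θ * t)) :
    (fastSet U γ).indicator (1 : (EuclideanSpace ℝ (Fin 3)) → ℝ≥0∞) (sphereChart e e₁ e₂ t z) ≤
      (levSet (chartFlux e e₁ e₂ U t) (θ * t) (γ * t ^ 2)).indicator 1 z := by
  have he : ‖e‖ = 1 := norm_frame₀ hon
  have h₁ : ‖e₁‖ = 1 := norm_frame₁ hon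
  have h₂ : ‖e₂‖ = 1 := norm_frame₂ hon
  have he1 : ⟪e, e₁⟫ = 0 := inner_frame₀₁ hon
  have he2 : ⟪e, e₂⟫ = 0 := inner_frame₀₂ hon
  have h12 : ⟪e₁, e₂⟫ = 0 := inner_frame₁₂ hon
  have hzr := mem_ball_zero_iff.1 hz
  have hzt : ‖z‖ ≤ t := by nlinarith [norm_nonneg z]
  by_cases hf : sphereChart e e₁ e₂ t z ∈ fastSet U γ
  · have hlev : z ∈ levSet (chartFlux e e₁ e₂ U t) (θ * t) (γ * t ^ 2) := by
      rw [mem_levSet]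
      refine ⟨hzr, ?_⟩
      have hf' : ⟪U (sphereChart e e₁ e₂ t z), sphereChart e e₁ e₂ t z⟫ + γ * ‖sphereChart e e₁ e₂ t z‖ ^ 2 < 0 := hf
      rw [norm_sphereChart he h₁ h₂ he1 he2 h12 ht.le hzt, real_inner_comm] at hf'
      rw [chartFlux]
      linarith
    rw [indicator_of_mem hf, indicator_of_mem hlev]
    simp
  · rw [indicator_of_notMem hf]
    exact bot_le

/-- `1/√(1 − (17/20)²) ≤ 2`. [arithmetic] -/
theorem sector_const_le_two : 1 / Real.sqrt (1 - (17 / 20 : ℝ) ^ 2) ≤ 2 := by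
  have h : (1 : ℝ) / 2 ≤ Real.sqrt (1 - (17 / 20 : ℝ) ^ 2) := by
    rw [show (1 : ℝ) / 2 = Real.sqrt ((1 / 2) ^ 2) by rw [Real.sqrt_sq (by norm_num)]]
    exact Real.sqrt_le_sqrt (by norm_num)
  calc 1 / Real.sqrt (1 - (17 / 20 : ℝ) ^ 2) ≤ 1 / (1 / 2) := one_div_le_one_div_of_le (by norm_num) h
    _ = 2 := by norm_num

/-- **THE TUBE OF ONE FRAME IS THIN.**  Over measurable radii `T ⊆ goodRadii` (thresholds `𝒜, ℰ ≥ 0`) inside `(R, 2R)`,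
`R > 0`, with `J ≥ 1` admissible uniformly (`bandConst·J²·(4𝒜/(γ²R²)) ≤ (R/20)²/8`,
`8·bandConst·J·(200/19)(𝒜 + (2R)²ℰ) ≤ (γR²/2)²`): `|tube e U γ T| ≤ (8𝒜/(γ²R))·e^{−J/4}`.
[reverse cone Tonelli + per-chart decay] -/
theorem volume_tube_le (hon : Orthonormal ℝ ![e, e₁, e₂]) (hU : ContDiff ℝ 1 U) {γ R 𝒜 ℰ : ℝ} (hγ : 0 < γ) (hR : 0 < R)
    (h𝒜 : 0 ≤ 𝒜) (hℰ : 0 ≤ ℰ) {T : Set ℝ} (hT : MeasurableSet T) (hTg : T ⊆ goodRadii e e₁ e₂ U R 𝒜 ℰ)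
    {J : ℕ} (hJ : 0 < J) (hJA : bandConst * (J : ℝ) ^ 2 * (4 * 𝒜 / (γ ^ 2 * R ^ 2)) ≤ (R / 20) ^ 2 / 8)
    (hJE : 8 * bandConst * (J : ℝ) * (200 / 19 * (𝒜 + (2 * R) ^ 2 * ℰ)) ≤ (γ * R ^ 2 / 2) ^ 2) :
    volume (tube e U γ T) ≤ ENNReal.ofReal (8 * 𝒜 / (γ ^ 2 * R) * Real.exp (-(J : ℝ) / 4)) := by
  have hTI : T ⊆ Ioo R (2 * R) := hTg.trans (goodRadii_subset e e₁ e₂ U R 𝒜 ℰ)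
  have hTpos : ∀ t ∈ T, 0 < t := fun t ht => hR.trans (hTI ht).1
  have hfast := measurableSet_fastSet hU.continuous γ
  have hg1 : Measurable ((fastSet U γ).indicator (1 : (EuclideanSpace ℝ (Fin 3)) → ℝ≥0∞)) := measurable_one.indicator hfast
  -- volume of the tube as an integral over the sector
  have hvol : volume (tube e U γ T) = ∫⁻ y in sector e T (17 / 20), (fastSet U γ).indicator 1 y := by
    rw [tube, lintegral_indicator_one hfast, Measure.restrict_apply hfast, inter_comm]
  -- per good radius: the chart fast set has small area
  have hdisc : ∀ t ∈ T, ∫⁻ z in ball (0 : ℂ) (17 / 20 * t), (fastSet U γ).indicator 1 (sphereChart e e₁ e₂ t z) ≤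
      ENNReal.ofReal (4 * 𝒜 / (γ ^ 2 * R ^ 2) * Real.exp (-(J : ℝ) / 4)) := by
    intro t ht
    have ht0 := hTpos t ht
    have htR : R ≤ t := (hTI ht).1.le
    have ht2R : t ≤ 2 * R := (hTI ht).2.le
    obtain ⟨-, hgA, hgE⟩ := hTg ht
    have hA : ∫⁻ z in ball (0 : ℂ) (9 / 10 * t), ‖U (sphereChart e e₁ e₂ t z)‖ₑ ^ 2 ≤ ENNReal.ofReal 𝒜 := le_of_lt hgA
    have hE : ∫⁻ z in ball (0 : ℂ) (9 / 10 * t), ‖fderiv ℝ U (sphereChart e e₁ e₂ t z)‖ₑ ^ 2 ≤ ENNReal.ofReal ℰ :=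
      le_of_lt hgE
    -- admissibility at radius t from the uniform one
    have hK := bandConst_nonneg
    have hJA' : bandConst * (J : ℝ) ^ 2 * (4 * 𝒜 / (γ ^ 2 * t ^ 2)) ≤ (t / 20) ^ 2 / 8 := by
      have h1 : 4 * 𝒜 / (γ ^ 2 * t ^ 2) ≤ 4 * 𝒜 / (γ ^ 2 * R ^ 2) := by
        apply div_le_div_of_nonneg_left (by positivity) (by positivity)
        exact mul_le_mul_of_nonneg_left (pow_le_pow_left₀ hR.le htR 2) (sq_nonneg γ)
      have h2 : (R / 20) ^ 2 / 8 ≤ (t / 20) ^ 2 / 8 := by gcongr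
      exact le_trans (mul_le_mul_of_nonneg_left h1 (by positivity)) (hJA.trans h2)
    have hJE' : 8 * bandConst * (J : ℝ) * (200 / 19 * (𝒜 + t ^ 2 * ℰ)) ≤ (γ * t ^ 2 / 2) ^ 2 := by
      have h1 : 200 / 19 * (𝒜 + t ^ 2 * ℰ) ≤ 200 / 19 * (𝒜 + (2 * R) ^ 2 * ℰ) := by
        have : t ^ 2 * ℰ ≤ (2 * R) ^ 2 * ℰ := mul_le_mul_of_nonneg_right (pow_le_pow_left₀ ht0.le ht2R 2) hℰ
        linarith
      have h2 : (γ * R ^ 2 / 2) ^ 2 ≤ (γ * t ^ 2 / 2) ^ 2 := by gcongr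
      exact le_trans (mul_le_mul_of_nonneg_left h1 (by positivity)) (hJE.trans h2)
    have hdecay := chart_fastArea_le hon hU ht0 hγ h𝒜 hℰ hA hE hJ hJA' hJE'
    -- volume of the level set from its toReal bound
    have hfin : volume (levSet (chartFlux e e₁ e₂ U t) (17 / 20 * t) (γ * t ^ 2)) ≠ ⊤ :=
      (measure_mono (fun z hz => mem_ball_zero_iff.2 hz.1) |>.trans_lt
        (measure_ball_lt_top (μ := volume) (x := (0 : ℂ)) (r := 17 / 20 * t))).ne
    have hlev : volume (levSet (chartFlux e e₁ e₂ U t) (17 / 20 * t) (γ * t ^ 2)) ≤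
        ENNReal.ofReal (4 * 𝒜 / (γ ^ 2 * R ^ 2) * Real.exp (-(J : ℝ) / 4)) := by
      rw [← ENNReal.ofReal_toReal hfin]
      refine ENNReal.ofReal_le_ofReal (hdecay.trans ?_)
      refine mul_le_mul_of_nonneg_right ?_ (Real.exp_pos _).le
      apply div_le_div_of_nonneg_left (by positivity) (by positivity)
      exact mul_le_mul_of_nonneg_left (pow_le_pow_left₀ hR.le htR 2) (sq_nonneg γ)
    calc ∫⁻ z in ball (0 : ℂ) (17 / 20 * t), (fastSet U γ).indicator 1 (sphereChart e e₁ e₂ t z)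
        ≤ ∫⁻ z in ball (0 : ℂ) (17 / 20 * t), (levSet (chartFlux e e₁ e₂ U t) (17 / 20 * t) (γ * t ^ 2)).indicator 1 z :=
          setLIntegral_mono' measurableSet_ball fun z hz =>
            indicator_fastSet_sphereChart_le hon ht0 (by norm_num) hz
      _ ≤ ∫⁻ z, (levSet (chartFlux e e₁ e₂ U t) (17 / 20 * t) (γ * t ^ 2)).indicator 1 z := setLIntegral_le_lintegral _ _
      _ = volume (levSet (chartFlux e e₁ e₂ U t) (17 / 20 * t) (γ * t ^ 2)) :=
          lintegral_indicator_one (measurableSet_levSet (continuous_chartFlux hU.continuous t) _ _)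
      _ ≤ ENNReal.ofReal (4 * 𝒜 / (γ ^ 2 * R ^ 2) * Real.exp (-(J : ℝ) / 4)) := hlev
  -- reverse cone Tonelli
  have hsec := lintegral_sector_le hon hg1 hT hTpos (θ := 17 / 20) (by norm_num) (by norm_num)
  have hTvol : volume T ≤ ENNReal.ofReal R := by
    refine (measure_mono hTI).trans ?_
    rw [Real.volume_Ioo]
    exact ENNReal.ofReal_le_ofReal (by linarith)
  calc volume (tube e U γ T) = ∫⁻ y in sector e T (17 / 20), (fastSet U γ).indicator 1 y := hvol
    _ ≤ ENNReal.ofReal (1 / Real.sqrt (1 - (17 / 20 : ℝ) ^ 2)) *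
          ∫⁻ t in T, ∫⁻ z in ball (0 : ℂ) (17 / 20 * t), (fastSet U γ).indicator 1 (sphereChart e e₁ e₂ t z) := hsec
    _ ≤ ENNReal.ofReal 2 * ∫⁻ t in T, ENNReal.ofReal (4 * 𝒜 / (γ ^ 2 * R ^ 2) * Real.exp (-(J : ℝ) / 4)) :=
        mul_le_mul' (ENNReal.ofReal_le_ofReal sector_const_le_two) (setLIntegral_mono' hT hdisc)
    _ = ENNReal.ofReal 2 * (ENNReal.ofReal (4 * 𝒜 / (γ ^ 2 * R ^ 2) * Real.exp (-(J : ℝ) / 4)) * volume T) := by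
        rw [setLIntegral_const]
    _ ≤ ENNReal.ofReal 2 * (ENNReal.ofReal (4 * 𝒜 / (γ ^ 2 * R ^ 2) * Real.exp (-(J : ℝ) / 4)) * ENNReal.ofReal R) := by
        gcongr
    _ = ENNReal.ofReal (8 * 𝒜 / (γ ^ 2 * R) * Real.exp (-(J : ℝ) / 4)) := by
        rw [← ENNReal.ofReal_mul (by positivity), ← ENNReal.ofReal_mul (by norm_num)]
        congr 1
        field_simp
        ring

/-- The tube is measurable and lies in `B_{2R}`. [folklore] -/
theorem tube_measurable_subset (hUc : Continuous U) {γ R : ℝ} {T : Set ℝ} (hT : MeasurableSet T) (hTI : T ⊆ Ioo R (2 * R)) :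
    MeasurableSet (tube e U γ T) ∧ tube e U γ T ⊆ closedBall (0 : (EuclideanSpace ℝ (Fin 3))) (2 * R) := by
  refine ⟨(measurableSet_sector e hT _).inter (measurableSet_fastSet hUc γ), fun y hy => ?_⟩
  rw [mem_closedBall_zero_iff]
  exact (hTI (mem_sector.1 hy.1).1).2.le


/-- Per-frame package: over measurable radii `T ⊆ goodRadii` inside `(R,2R)` the tube is measurable, lies in
`B_{2R}`, and is thin. [assembly of `tube_measurable_subset`, `volume_tube_le`] -/
theorem tube_package (hon : Orthonormal ℝ ![e, e₁, e₂]) (hU : ContDiff ℝ 1 U) {γ R 𝒜 ℰ : ℝ} (hγ : 0 < γ) (hR : 0 < R)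
    (h𝒜 : 0 ≤ 𝒜) (hℰ : 0 ≤ ℰ) {T : Set ℝ} (hT : MeasurableSet T) (hTg : T ⊆ goodRadii e e₁ e₂ U R 𝒜 ℰ)
    {J : ℕ} (hJ : 0 < J) (hJA : bandConst * (J : ℝ) ^ 2 * (4 * 𝒜 / (γ ^ 2 * R ^ 2)) ≤ (R / 20) ^ 2 / 8)
    (hJE : 8 * bandConst * (J : ℝ) * (200 / 19 * (𝒜 + (2 * R) ^ 2 * ℰ)) ≤ (γ * R ^ 2 / 2) ^ 2) :
    MeasurableSet (tube e U γ T) ∧ tube e U γ T ⊆ closedBall (0 : (EuclideanSpace ℝ (Fin 3))) (2 * R) ∧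
      volume (tube e U γ T) ≤ ENNReal.ofReal (8 * 𝒜 / (γ ^ 2 * R) * Real.exp (-(J : ℝ) / 4)) := by
  obtain ⟨h1, h2⟩ := tube_measurable_subset (e := e) (γ := γ) hU.continuous hT
    (hTg.trans (goodRadii_subset e e₁ e₂ U R 𝒜 ℰ))
  exact ⟨h1, h2, volume_tube_le hon hU hγ hR h𝒜 hℰ hT hTg hJ hJA hJE⟩

/-- Two-sided cone membership: a fast point `z ≠ 0` with `‖z‖ ∈ T` in the double cone of `v` lies in the tube of
`v` or of `−v`. [folklore: sign split + `mem_sector_of_inner_sq`, `(17/20)² > 2/3`] -/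
theorem mem_tube_or {v z : (EuclideanSpace ℝ (Fin 3))} {γ : ℝ} {T : Set ℝ} (hzT : ‖z‖ ∈ T) (hz0 : z ≠ 0)
    (hfast : z ∈ fastSet U γ) (hcone : ‖z‖ ^ 2 / 3 ≤ ⟪z, v⟫ ^ 2) :
    z ∈ tube v U γ T ∨ z ∈ tube (-v) U γ T := by
  have hθ : (2 : ℝ) / 3 < (17 / 20 : ℝ) ^ 2 := by norm_num
  have hθ1 : (17 / 20 : ℝ) ^ 2 ≤ 1 := by norm_num
  rcases le_total 0 ⟪z, v⟫ with hs | hs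
  · exact Or.inl ⟨mem_sector_of_inner_sq hθ hθ1 hzT hz0 hs hcone, hfast⟩
  · refine Or.inr ⟨mem_sector_of_inner_sq hθ hθ1 hzT hz0 ?_ ?_, hfast⟩
    · rw [inner_neg_right]; linarith
    · rw [inner_neg_right, neg_sq]; exact hcone

end Summit.NavierStokesRegularity.NavierStokesRegularity.Theorems.PowerGaugeEulerLiouville.NeedleFastSetMeasure
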